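import Summits.ValiantsHypothesis.ValiantsHypothesis.Theorems.KPlusLogSqLawStaticTridiagonalGauge
import Summits.ValiantsHypothesis.ValiantsHypothesis.Theorems.KPlusLogSqLawMonotonePencilInertia
import Literature.Algebra.Polynomial.DescartesSignVariations

/-!
# Route «KPlusLogSqLaw», crux `WeakLifting` (stmt-ValiantsHypothesis-19561) — REAL side of the tridiagonal sector:
# the FULL-CONE LAW FOR ARBITRARY LINKS — a static definite symmetric tridiagonal design whose integer GAUGE EXPONENTS are all `≥ 1`
# (the cone) or all `≤ −1` (the anticone) has at most `⌊m/2⌋` distinct positive determinant zeros (all sizes, matrix currency)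

HONEST FRAMING.  Helper (`--supports stmt-ValiantsHypothesis-19561 --as helper`), seat val-sym-lift-p2 (g16), cell `pub-symmetroid`,
2026-08-28; α register (static definite symmetric tridiagonal row `B m`), UPPER side; the desk's first move (2) for this seat («full-cone law
for arbitrary links»).  A COMPOSITION of three tree results, no new mechanism: lift-p1 g10's DIAGONAL GAUGE (`StaticTridiagonalGauge.isRoot_det_iff`:
`det F(x) = 0 ⟺ det(diag(c_ii x^{e_ii + 2t_i}) + A) = 0` for `x ≠ 0`, `A` the constant matrix of link coefficients, `t` integers with
`t_i + t_j = −e_ij` on the band), lift-p2 g10's abstract INERTIA LAW (`MonotoneInertia.card_posRoots_le_card_negEigen`: a strictly Loewner-increasing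
symmetric family above a constant `C'` has at most `#{negative eigenvalues of C'}` determinant zeros among the positive roots of any polynomial) with
its hollow-tridiagonal count (`card_negEigen_le_half`: `≤ ⌊m/2⌋`), and — for the anticone — the reversed polynomial (`Literature…Descartes.roots_reverse_of_ne_zero`,
roots `x ↦ x⁻¹`).  The desk's α target (a linear ALL-designs law) is NOT proved; α stays NO MOVER.

WHAT IS PROVED (`F(X) = (c_ij X^{e_ij})`, `c`, `e` symmetric, `c = 0` off the band, `0 < c_ii`; `t : Fin m → ℤ` any integer gauge with
`t_i + t_j = −e_ij` for `|i − j| = 1` — one exists for every design, `StaticTridiagonalGauge.exists_gaugeExp`, and all of them differ by the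
alternating shift `t_i ↦ t_i + (−1)^i δ`; the GAUGE EXPONENTS are `g_i := e_ii + 2 t_i`, the exponents of the diagonal after the congruence that makes
all links constant — the negatives of val-sym-lift-p2 g15's «virtual vertex exponents» up to the factor conventions):
* **`card_posRoots_det_le_half_of_gaugeCone` (CONE, all sizes)**: if `g_i ≥ 1` for all `i`, then `#posRoots(det F) ≤ ⌊m/2⌋`.
* **`card_posRoots_det_le_half_of_gaugeAnticone` (ANTICONE, all sizes)**: if `g_i ≤ −1` for all `i`, then `#posRoots(det F) ≤ ⌊m/2⌋`.
* `card_posRoots_reverse` — bookkeeping: a real polynomial and its reverse have the same number of distinct positive roots.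
This extends lift-p2 g10's `card_posRoots_constLinks_le_half` (constant links, `e_ij = 0` off the diagonal, `t = 0`) from the vertex gauge to EVERY
design whose gauge exponents are one-signed in some INTEGER gauge; g15's one-type laws `derivative_mul_prev_pos_of_cone'` (every root is a creation) are
the continuant face of the same monotonicity.  HALF-INTEGER GAUGES: if the one-signed gauge needs `δ ∈ ½ℤ`, double every exponent first (`x ↦ x²`
preserves the positive root count) — not typed here.  The slope reading: edge slopes `L_k = 2e_{k,k+1} − e_kk − e_{k+1,k+1} = −(g_k + g_{k+1})`, so the
cone is `{L_k = −(g_k + g_{k+1}), g ≥ 1}` — g15's located `4 × 4` witness with slopes `(2, 6, 2)` (three zeros `> ⌊4/2⌋`) lies outside both cones.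
Nothing here bears on `WeakLifting` / `TropicalB` (stmt-19771) in their windows, on Conjecture B, on the Door-A registers, on `MatrixDescartes`
(stmt-ValiantsHypothesis-18050) or on VP ≠ VNP.
[folklore: Weyl monotonicity + Cauchy interlacing, diagonal monomial congruence; the composition is this seat's bookkeeping]
-/

set_option linter.dupNamespace false
set_option autoImplicit false

namespace Summit.ValiantsHypothesis.ValiantsHypothesis.Theorems.KPlusLogSqLaw

namespace StaticTridiagonalGauge

open Matrix Polynomial Finset
open Summit.ValiantsHypothesis.ValiantsHypothesis.Theorems.KPlusLogSqLaw.MonotoneInertia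
  (card_posRoots_le_card_negEigen card_negEigen_le_half)

variable {m : ℕ}

/-! ## 1. The constant link matrix is hollow-odd and symmetric -/

/-- The constant link matrix `A` of the gauge normal form vanishes at all entries `(i, j)` with `i + j` even. [bookkeeping] -/
theorem linkMatrix_even_zero (c : Fin m → Fin m → ℝ) (i j : Fin m) (hij : Even ((i : ℕ) + j)) :
    (Matrix.of fun i j : Fin m => if (i : ℕ) + 1 = j ∨ (j : ℕ) + 1 = i then c i j else 0) i j = 0 := by
  rw [Matrix.of_apply, if_neg]
  rintro (h | h)
  · rw [← h] at hij; obtain ⟨r, hr⟩ := hij; omega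
  · rw [← h] at hij; obtain ⟨r, hr⟩ := hij; omega

/-- The constant link matrix is symmetric when `c` is. [bookkeeping] -/
theorem linkMatrix_isHermitian (c : Fin m → Fin m → ℝ) (hc : ∀ i j, c i j = c j i) :
    (Matrix.of fun i j : Fin m => if (i : ℕ) + 1 = j ∨ (j : ℕ) + 1 = i then c i j else 0).IsHermitian := by
  refine Matrix.IsHermitian.ext fun i j => ?_
  simp only [Matrix.of_apply, star_trivial]
  by_cases h : (j : ℕ) + 1 = i ∨ (i : ℕ) + 1 = j
  · rw [if_pos h, if_pos (Or.symm h), hc]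
  · rw [if_neg h, if_neg (fun h' => h (Or.symm h'))]

/-! ## 2. The monotone family of the cone -/

/-- The diagonal-monomial family `s ↦ diag(c_ii s^{n_i}) + A` (`0 < c_ii`, `n_i ≥ 1`) is symmetric, strictly Loewner increasing on `(0, ∞)` and
strictly above `A` there — the hypotheses of `MonotoneInertia.card_posRoots_le_card_negEigen`. [folklore] -/
theorem monotoneFamily_hyps (c : Fin m → Fin m → ℝ) (hdiag : ∀ i, 0 < c i i) (n : Fin m → ℕ) (hn : ∀ i, 1 ≤ n i)
    (A : Matrix (Fin m) (Fin m) ℝ) (hA : A.IsHermitian) :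
    (∀ s, (Matrix.diagonal (fun i => c i i * s ^ n i) + A).IsHermitian) ∧
    (∀ s s' : ℝ, 0 < s → s < s' →
      ((Matrix.diagonal (fun i => c i i * s' ^ n i) + A) - (Matrix.diagonal (fun i => c i i * s ^ n i) + A)).PosDef) ∧
    (∀ s : ℝ, 0 < s → ((Matrix.diagonal (fun i => c i i * s ^ n i) + A) - A).PosDef) := by
  refine ⟨fun s => (Matrix.isHermitian_diagonal _).add hA, fun s s' hs hss' => ?_, fun s hs => ?_⟩
  · have hsub : (Matrix.diagonal (fun i => c i i * s' ^ n i) + A) - (Matrix.diagonal (fun i => c i i * s ^ n i) + A) =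
        Matrix.diagonal (fun i => c i i * (s' ^ n i - s ^ n i)) := by
      ext i j
      simp only [Matrix.sub_apply, Matrix.add_apply, Matrix.diagonal_apply]
      split_ifs <;> ring
    rw [hsub]
    refine Matrix.PosDef.diagonal fun i => mul_pos (hdiag i) (sub_pos.mpr ?_)
    exact pow_lt_pow_left₀ hss' hs.le (Nat.one_le_iff_ne_zero.mp (hn i))
  · have hsub : (Matrix.diagonal (fun i => c i i * s ^ n i) + A) - A = Matrix.diagonal (fun i => c i i * s ^ n i) := by
      ext i j
      simp only [Matrix.sub_apply, Matrix.add_apply, Matrix.diagonal_apply]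
      split_ifs <;> ring
    rw [hsub]
    exact Matrix.PosDef.diagonal fun i => mul_pos (hdiag i) (pow_pos hs _)

/-! ## 3. The cone -/

/-- **FULL-CONE LAW FOR ARBITRARY LINKS (all sizes).**  A static definite symmetric tridiagonal monomial matrix `(c_ij X^{e_ij})` (`c`, `e` symmetric,
`c = 0` off the band, `0 < c_ii`) admitting an integer gauge `t` (`t_i + t_j = −e_ij` on the band) with ALL GAUGE EXPONENTS `e_ii + 2 t_i ≥ 1` has at
most `⌊m/2⌋` distinct positive determinant zeros. [this file: gauge transfer + inertia law] -/
theorem card_posRoots_det_le_half_of_gaugeCone (c : Fin m → Fin m → ℝ) (e : Fin m → Fin m → ℕ)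
    (hc : ∀ i j, c i j = c j i) (hband : ∀ i j : Fin m, (i : ℕ) + 1 < j ∨ (j : ℕ) + 1 < i → c i j = 0)
    (hdiag : ∀ i, 0 < c i i)
    (t : Fin m → ℤ) (ht : ∀ i j : Fin m, ((i : ℕ) + 1 = j ∨ (j : ℕ) + 1 = i) → t i + t j = -(e i j : ℤ))
    (hcone : ∀ i, 1 ≤ (e i i : ℤ) + 2 * t i) :
    ((Matrix.det (Matrix.of fun i j => C (c i j) * (X : ℝ[X]) ^ e i j)).roots.toFinset.filter
      (fun x : ℝ => 0 < x)).card ≤ m / 2 := by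
  classical
  set A : Matrix (Fin m) (Fin m) ℝ := Matrix.of fun i j : Fin m => if (i : ℕ) + 1 = j ∨ (j : ℕ) + 1 = i then c i j else 0 with hAdef
  have hA : A.IsHermitian := linkMatrix_isHermitian c hc
  -- natural gauge exponents
  set n : Fin m → ℕ := fun i => ((e i i : ℤ) + 2 * t i).toNat with hn
  have hn1 : ∀ i, 1 ≤ n i := by
    intro i
    have h := hcone i
    simp only [hn]
    omega
  have hncast : ∀ i, ((n i : ℕ) : ℤ) = (e i i : ℤ) + 2 * t i := fun i => by
    simp only [hn]; exact Int.toNat_of_nonneg (by linarith [hcone i])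
  obtain ⟨hG, hstrict, habove⟩ := monotoneFamily_hyps c hdiag n hn1 A hA
  refine (card_posRoots_le_card_negEigen (fun s => Matrix.diagonal (fun i => c i i * s ^ n i) + A) hG hstrict hA habove _
    fun s hs hroot => ?_).trans (card_negEigen_le_half hA fun i j hij => linkMatrix_even_zero c i j hij)
  -- at a positive root, the gauge normal form is singular, and `s ^ (g_i : ℤ) = s ^ n_i`
  have h := (isRoot_det_iff c e hband t ht (ne_of_gt hs)).mp hroot
  have hmat : Matrix.diagonal (fun i => c i i * s ^ ((e i i : ℤ) + 2 * t i)) + A =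
      Matrix.diagonal (fun i => c i i * s ^ n i) + A := by
    congr 1
    ext i j
    simp only [Matrix.diagonal_apply]
    split_ifs
    · rw [← hncast, zpow_natCast]
    · rfl
  rw [← hmat]
  exact h

/-! ## 4. Reversal bookkeeping and the anticone -/

/-- A real polynomial and its reverse have the same number of distinct positive roots (`x ↦ x⁻¹`). [folklore] -/
theorem card_posRoots_reverse (P : ℝ[X]) :
    ((P.reverse.roots.toFinset.filter (fun x : ℝ => 0 < x)).card) = (P.roots.toFinset.filter (fun x : ℝ => 0 < x)).card := by
  classical
  by_cases hP : P = 0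
  · subst hP; simp
  have hrev := Literature.Algebra.Polynomial.Descartes.roots_reverse_of_ne_zero (K := ℝ) hP
  -- the positive roots of `P.reverse` are exactly the inverses of the positive roots of `P`
  have hset : P.reverse.roots.toFinset.filter (fun x : ℝ => 0 < x) =
      (P.roots.toFinset.filter (fun x : ℝ => 0 < x)).image (fun x : ℝ => x⁻¹) := by
    ext y
    simp only [Finset.mem_filter, Multiset.mem_toFinset, Finset.mem_image, hrev, Multiset.mem_map, Multiset.mem_filter]
    constructor
    · rintro ⟨⟨x, ⟨hx, hx0⟩, rfl⟩, hy⟩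
      exact ⟨x, ⟨hx, inv_pos.mp hy⟩, rfl⟩
    · rintro ⟨x, ⟨hx, hxpos⟩, rfl⟩
      exact ⟨⟨x, ⟨hx, ne_of_gt hxpos⟩, rfl⟩, inv_pos.mpr hxpos⟩
  rw [hset]
  exact Finset.card_image_of_injective _ inv_injective

/-- **FULL-ANTICONE LAW FOR ARBITRARY LINKS (all sizes).**  Same matrix class; if an integer gauge has ALL GAUGE EXPONENTS `e_ii + 2 t_i ≤ −1`,
the matrix has at most `⌊m/2⌋` distinct positive determinant zeros (apply the cone law to `x ↦ x⁻¹`, i.e. to the reversed determinant).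
[this file] -/
theorem card_posRoots_det_le_half_of_gaugeAnticone (c : Fin m → Fin m → ℝ) (e : Fin m → Fin m → ℕ)
    (hc : ∀ i j, c i j = c j i) (hband : ∀ i j : Fin m, (i : ℕ) + 1 < j ∨ (j : ℕ) + 1 < i → c i j = 0)
    (hdiag : ∀ i, 0 < c i i)
    (t : Fin m → ℤ) (ht : ∀ i j : Fin m, ((i : ℕ) + 1 = j ∨ (j : ℕ) + 1 = i) → t i + t j = -(e i j : ℤ))
    (hanti : ∀ i, (e i i : ℤ) + 2 * t i ≤ -1) :
    ((Matrix.det (Matrix.of fun i j => C (c i j) * (X : ℝ[X]) ^ e i j)).roots.toFinset.filter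
      (fun x : ℝ => 0 < x)).card ≤ m / 2 := by
  classical
  set P : ℝ[X] := Matrix.det (Matrix.of fun i j => C (c i j) * (X : ℝ[X]) ^ e i j) with hPdef
  set A : Matrix (Fin m) (Fin m) ℝ := Matrix.of fun i j : Fin m => if (i : ℕ) + 1 = j ∨ (j : ℕ) + 1 = i then c i j else 0 with hAdef
  have hA : A.IsHermitian := linkMatrix_isHermitian c hc
  set n : Fin m → ℕ := fun i => (-((e i i : ℤ) + 2 * t i)).toNat with hn
  have hn1 : ∀ i, 1 ≤ n i := by
    intro i
    have h := hanti i
    simp only [hn]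
    omega
  have hncast : ∀ i, ((n i : ℕ) : ℤ) = -((e i i : ℤ) + 2 * t i) := fun i => by
    simp only [hn]; exact Int.toNat_of_nonneg (by linarith [hanti i])
  obtain ⟨hG, hstrict, habove⟩ := monotoneFamily_hyps c hdiag n hn1 A hA
  rw [← card_posRoots_reverse P]
  by_cases hP0 : P = 0
  · rw [hP0, Polynomial.reverse_zero, Polynomial.roots_zero]; simp
  refine (card_posRoots_le_card_negEigen (fun s => Matrix.diagonal (fun i => c i i * s ^ n i) + A) hG hstrict hA habove _
    fun s hs hroot => ?_).trans (card_negEigen_le_half hA fun i j hij => linkMatrix_even_zero c i j hij)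
  -- `s` is a positive root of `P.reverse`, so `x = s⁻¹` is a positive root of `P`
  have hmem : s ∈ P.reverse.roots := Polynomial.mem_roots'.mpr ⟨fun h => hP0 (Polynomial.reverse_eq_zero.mp h), hroot⟩
  rw [Literature.Algebra.Polynomial.Descartes.roots_reverse_of_ne_zero (K := ℝ) hP0, Multiset.mem_map] at hmem
  obtain ⟨x, hx, hxs⟩ := hmem
  rw [Multiset.mem_filter] at hx
  have hxroot : P.IsRoot x := (Polynomial.mem_roots'.mp hx.1).2
  have hx0 : x ≠ 0 := hx.2
  have h := (isRoot_det_iff c e hband t ht hx0).mp hxroot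
  -- `x ^ (g_i : ℤ) = s ^ n_i` with `s = x⁻¹`, `n_i = −g_i`
  have hmat : Matrix.diagonal (fun i => c i i * x ^ ((e i i : ℤ) + 2 * t i)) + A =
      Matrix.diagonal (fun i => c i i * s ^ n i) + A := by
    congr 1
    ext i j
    simp only [Matrix.diagonal_apply]
    split_ifs
    · congr 1
      rw [← hxs, ← zpow_natCast, _root_.inv_zpow', hncast, neg_neg]
    · rfl
  rw [← hmat]
  exact h

end StaticTridiagonalGauge

end Summit.ValiantsHypothesis.ValiantsHypothesis.Theorems.KPlusLogSqLaw
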